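import Summits.RiemannHypothesis.RiemannHypothesis.Theorems.WeilGroundStateGroundStatesConvergeToXiExpClassHarmonic
import Summits.RiemannHypothesis.RiemannHypothesis.Theorems.WeilGroundStateGroundStatesConvergeToXiStubStrongClassPairing
import Summits.RiemannHypothesis.RiemannHypothesis.Theorems.WeilGroundStateGroundStatesConvergeToXiStubMellinDivideStrong
import Summits.RiemannHypothesis.RiemannHypothesis.Theorems.WeilGroundStateGroundStatesConvergeToXiStubHarmonicExtension
import Summits.RiemannHypothesis.RiemannHypothesis.Theorems.WeilGroundStateGroundStatesConvergeToXiStubPhiDivideIterate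
import Summits.RiemannHypothesis.RiemannHypothesis.Theorems.WeilGroundStateGroundStatesConvergeToXiStubPhiIteratedDerivEnvelope
import Literature.NumberTheory.LFunctions.WeilExplicit
import Literature.NumberTheory.LFunctions.WeilExplicitFormulaProofs
import Literature.NumberTheory.LFunctions.RiemannXi
import Literature.NumberTheory.LFunctions.RiemannXiProofs
import Literature.NumberTheory.LFunctions.ZetaZeros
import Mathlib.Analysis.Calculus.IteratedDeriv.Lemmas
import HarnessLib

/-!
# `WeilGroundState.GroundStatesConvergeToXi` — the harmonic weak-limit closure (crux item
stmt-RiemannHypothesis-1527, route route-RiemannHypothesis-WeilGroundState; line `Sketch`, lead c8,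
wave 4; `--supports`; RH-free)

First lemma of the crux idea card `harmonic-weak-limit-closure`, in the sharp RH-free form:

* `stub_harmonic_closure` / `harmonic_closure` — **a WEIL-HARMONIC function of the weighted class
  has Mellin transform vanishing at EVERY non-trivial zero of `ζ`, on the critical line or not.**
  Hypotheses: `v` measurable, `∫ ‖v‖ e^{b₁|t|} < ∞` for some `b₁ > 1/2`, and `W(v ⋆ g̃) = 0` for
  every test function `g` (Weil-harmonicity against the form core — the limit form of the weak
  Euler–Lagrange equation of renormalised ground states when the ground energies tend to `0`).
  Conclusion: `v̂(ρ) = weilMellin v ρ = 0` for every `ρ` with `ζ(ρ) = 0`, `0 < Re ρ < 1`.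

Mechanism (all RH-free, assembled from the registered stubs of rev L10g): for a zero `ρ₀` put
`s₀ = 1 − conj ρ₀` (a zero of `ξ`, `ξ(1−s) = ξ(s)`, `ξ(conj s) = conj ξ(s)`).  Dividing the
transform of Riemann's kernel `Φ` (`Φ̂ = ξ`; all derivatives `O(e^{-|t|})`,
`stub_phi_iteratedDeriv_envelope`) by `s − s₀` inside the exponential class as long as it vanishes
at `s₀` (`stub_mellin_divide(_strong)`) must stop — else `ξ` would be flat at `s₀` and `≡ 0` —
and yields `h` in the class with `(s − s₀)^m ĥ = ξ` in the closed strip and `ĥ(s₀) ≠ 0`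
(`stub_phi_divide_iterate`).  Harmonicity against tests extends to `h` by truncation and dominated
convergence on the zero side (`stub_harmonic_extension`), and the class explicit formula
(`explicit_formula_expClass'`) applied to `v ⋆ h̃` (class membership and
`(v ⋆ h̃)^ = v̂ · conj ĥ(1 − conj ·)`, `stub_strongClass_pairing`) turns `0 = W(v ⋆ h̃)` into
`Σ_ρ m(ρ) v̂(ρ) conj ĥ(1 − conj ρ) = 0`, in which only `ρ = ρ₀` survives: `m(ρ₀) v̂(ρ₀) conj ĥ(s₀) = 0`.

So the only freedom left in a Weil-harmonic candidate limit of renormalised ground states is an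
entire factor: `v̂ = ξ · G` at the level of VALUES at the zeros (the explicit-formula functional
sees values with multiplicity weights, not derivatives) — CCM25's missing step 2 ("`k_λ ≈ θ`")
isolated as `G ≡ const`.  No new definitions.
-/

noncomputable section

set_option linter.dupNamespace false

open scoped Topology Real ComplexConjugate ArithmeticFunction.vonMangoldt
open Filter Set MeasureTheory Complex

namespace Summit.RiemannHypothesis.RiemannHypothesis.Theorems.GroundStatesConvergeToXi

open Literature.NumberTheory.LFunctions

/-- Rate conversion: `e^{-|t|} ≤ e^{-b|t|}` for `b ≤ 1`. [folklore] -/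
theorem strongClass_rate_mono {h : ℝ → ℂ} {b : ℝ} (hb : b ≤ 1)
    (hbd : ∀ k : ℕ, ∃ C : ℝ, ∀ t : ℝ, ‖iteratedDeriv k h t‖ ≤ C * Real.exp (-(1 * |t|))) :
    ∀ k : ℕ, ∃ C : ℝ, ∀ t : ℝ, ‖iteratedDeriv k h t‖ ≤ C * Real.exp (-(b * |t|)) := by
  intro k
  obtain ⟨C, hC⟩ := hbd k
  refine ⟨max C 0, fun t => (hC t).trans ?_⟩
  have hC0 : C ≤ max C 0 := le_max_left _ _
  have h1 : Real.exp (-(1 * |t|)) ≤ Real.exp (-(b * |t|)) :=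
    Real.exp_le_exp.2 (by nlinarith [abs_nonneg t])
  calc C * Real.exp (-(1 * |t|)) ≤ max C 0 * Real.exp (-(1 * |t|)) := by gcongr
    _ ≤ max C 0 * Real.exp (-(b * |t|)) := by gcongr

/-- **THE HARMONIC WEAK-LIMIT CLOSURE (RH-free modulo K1–K4).**  Let `v : ℝ → ℂ` be measurable
with `∫ ‖v‖ e^{b₁|t|} < ∞` for some `b₁ > 1/2`, and WEIL-HARMONIC against the form core:
`W(v ⋆ g̃) = 0` for every test function `g`.  Then the Mellin transform of `v` VANISHES AT EVERY
NON-TRIVIAL ZERO of `ζ`, on the critical line or not: `v̂(ρ) = 0`.  (So `v̂/ξ` has no pole coming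
from a simple zero; the only freedom left in a harmonic limit of renormalised ground states is an
entire factor — CCM25's missing step 2 in one line.)  Proof: for `ρ₀` put `s₀ = 1 − conj ρ₀`
(a zero of `ξ`); `stub_phi_divide_iterate` gives `h` in the strong class with
`(s − s₀)^m ĥ(s) = ξ(s)` and `ĥ(s₀) ≠ 0`; `h` is harmonic for `v` (`stub_harmonic_extension`), and by
the class explicit formula `0 = W(v ⋆ h̃) = Σ_ρ m(ρ) v̂(ρ) conj ĥ(1 − conj ρ)`, where every term with
`ρ ≠ ρ₀` vanishes (`ĥ = ξ/(s−s₀)^m` at a zero `s ≠ s₀` of `ξ`); hence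
`m(ρ₀) v̂(ρ₀) conj ĥ(s₀) = 0`. [folklore] -/
theorem harmonic_closure {v : ℝ → ℂ} {b₁ : ℝ} (hv : AEStronglyMeasurable v volume)
    (hb₁ : 1 / 2 < b₁) (hint : Integrable (fun t : ℝ => ‖v t‖ * Real.exp (b₁ * |t|)))
    (hharm : ∀ g : ℝ → ℂ, IsWeilTest g → weilFunctional (weilConv v (weilReflect g)) = 0)
    {ρ₀ : ℂ} (hρ₀ : ρ₀ ∈ ZetaZeros.riemannZetaNontrivialZeros) :
    weilMellin v ρ₀ = 0 := by
  have h0 := ZetaZeros.riemannZetaNontrivialZeros.re_pos hρ₀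
  have h1 := ZetaZeros.riemannZetaNontrivialZeros.re_lt_one hρ₀
  -- the zero `s₀ = 1 - conj ρ₀` of `ξ`
  set s₀ : ℂ := 1 - conj ρ₀ with hs₀def
  have hs₀re : s₀.re = 1 - ρ₀.re := by simp [hs₀def]
  have hξs₀ : riemannXi s₀ = 0 := by
    rw [hs₀def, riemannXi_one_sub, riemannXi_conj_holds,
      riemannXi_eq_zero_of_mem_riemannZetaNontrivialZeros hρ₀, map_zero]
  obtain ⟨m, h, hcd, hbd, hdiv, hne⟩ := stub_phi_divide_iterate stub_mellin_divide_strong s₀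
    (by rw [hs₀re]; linarith) (by rw [hs₀re]; linarith) hξs₀
  -- rates
  set b₀ : ℝ := min 1 b₁ with hb₀def
  have hb₀ : 1 / 2 < b₀ := lt_min (by norm_num) hb₁
  have hb₀le : b₀ ≤ b₁ := min_le_right _ _
  have hbd' := strongClass_rate_mono (min_le_left 1 b₁) hbd
  -- harmonicity against `h`, and the pairing through the class explicit formula
  have hW : weilFunctional (weilConv v (weilReflect h)) = 0 :=
    stub_harmonic_extension explicit_formula_expClass' stub_strongClass_pairing v b₁ hv hb₁ hint
      hharm h b₀ hcd hb₀ hb₀le hbd'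
  obtain ⟨hFcd, hFbd, hFmel⟩ := stub_strongClass_pairing v h b₁ b₀ hv hb₁ hint hcd hb₀ hb₀le hbd'
  obtain ⟨C, hC0, hC1, hC2⟩ := hExt_deriv_bounds_of_all hFbd
  obtain ⟨-, hsum⟩ := explicit_formula_expClass' _ C b₀ hFcd hb₀ hC0 hC1 hC2
  rw [hW] at hsum
  -- only `ρ₀` contributes to the zero side
  have hterm : ∀ ρ : ZetaZeros.riemannZetaNontrivialZeros, ρ ≠ ⟨ρ₀, hρ₀⟩ →
      (riemannZetaZeroOrder (ρ : ℂ) : ℂ) * weilMellin (weilConv v (weilReflect h)) ρ = 0 := by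
    intro ρ hρ
    have hρ0 := ZetaZeros.riemannZetaNontrivialZeros.re_pos ρ.2
    have hρ1 := ZetaZeros.riemannZetaNontrivialZeros.re_lt_one ρ.2
    rw [hFmel ρ hρ0.le hρ1.le]
    -- `ĥ(1 - conj ρ) = 0`: it is `ξ/(s - s₀)^m` at a zero `s ≠ s₀` of `ξ`
    set s : ℂ := 1 - conj (ρ : ℂ) with hsdef
    have hsre : s.re = 1 - (ρ : ℂ).re := by simp [hsdef]
    have hss₀ : s ≠ s₀ := by
      intro hss
      apply hρ
      have : (ρ : ℂ) = ρ₀ := by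
        have h2 : conj (ρ : ℂ) = conj ρ₀ := by
          rw [hsdef, hs₀def] at hss
          linear_combination -hss
        simpa using congrArg conj h2
      exact Subtype.ext this
    have hξs : riemannXi s = 0 := by
      rw [hsdef, riemannXi_one_sub, riemannXi_conj_holds,
        riemannXi_eq_zero_of_mem_riemannZetaNontrivialZeros ρ.2, map_zero]
    have hh : weilMellin h s = 0 := by
      have := hdiv s (by rw [hsre]; linarith) (by rw [hsre]; linarith)
      rw [hξs] at this
      exact (mul_eq_zero.1 this).resolve_left (pow_ne_zero _ (sub_ne_zero.2 hss₀))
    rw [hh, map_zero, mul_zero, mul_zero]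
  rw [tsum_eq_single ⟨ρ₀, hρ₀⟩ hterm] at hsum
  -- `m(ρ₀) v̂(ρ₀) conj ĥ(s₀) = 0`
  have hm : (riemannZetaZeroOrder ρ₀ : ℂ) ≠ 0 := by
    have hζ : riemannZeta ρ₀ = 0 := ZetaZeros.riemannZetaNontrivialZeros.zeta_eq_zero hρ₀
    have hpos := (riemannZetaZeroOrder_pos_iff
      (ZetaZeros.riemannZetaNontrivialZeros.ne_one hρ₀)).2 hζ
    exact_mod_cast hpos.ne'
  have hmel := hFmel ρ₀ h0.le h1.le
  simp only [] at hsum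
  rw [hmel] at hsum
  have hconj : conj (weilMellin h (1 - conj ρ₀)) ≠ 0 := by
    rw [← hs₀def]
    exact (map_ne_zero _).2 hne
  exact (mul_eq_zero.1 ((mul_eq_zero.1 hsum).resolve_left hm)).resolve_right hconj

/-- **The harmonic weak-limit closure, registered uncurried form (stub K5 of line `Sketch`).**
[folklore] -/
theorem stub_harmonic_closure :
    ∀ (v : ℝ → ℂ) (b₁ : ℝ) (ρ₀ : ℂ), AEStronglyMeasurable v volume → 1 / 2 < b₁ →
      Integrable (fun t : ℝ => ‖v t‖ * Real.exp (b₁ * |t|)) →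
      (∀ g : ℝ → ℂ, IsWeilTest g → weilFunctional (weilConv v (weilReflect g)) = 0) →
      ρ₀ ∈ ZetaZeros.riemannZetaNontrivialZeros → weilMellin v ρ₀ = 0 :=
  fun _ _ _ hv hb₁ hint hharm hρ₀ => harmonic_closure hv hb₁ hint hharm hρ₀

/-- **Riemann's kernel is the model case**: `Φ` itself is Weil-harmonic (`phi_conv_harmonic`) and
indeed `Φ̂ = ξ` vanishes at every non-trivial zero — consistent with (and a sanity check of) the
closure. [folklore] -/
theorem weilMellin_phi_eq_zero_of_mem {ρ : ℂ} (hρ : ρ ∈ ZetaZeros.riemannZetaNontrivialZeros) :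
    weilMellin (fun t : ℝ => (2 : ℂ) * LagariasMontague.Psic (2 * t)) ρ = 0 := by
  rw [stub_mellinXi stub_psiDecay.1 stub_psiDecay.2 ρ]
  exact riemannXi_eq_zero_of_mem_riemannZetaNontrivialZeros hρ

end Summit.RiemannHypothesis.RiemannHypothesis.Theorems.GroundStatesConvergeToXi

end
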